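import Literature.AnabelianGeometry.EtaleTheta.Discharge.Sec2Cor218iAtModelTateOfExtends
import HarnessLib

/-!
# [EtTh] Thm. 1.6 (i) / Cor. 2.18 (i) (F-0620) AT THE STAGE-2 TATE MODEL `ThetaSetting.modelχq p i 2` over ARBITRARY
# (non-inner) automorphisms of `G_{ℚ_p}`, part 1: THE DEFECT FORMULA and THE LEVEL-4 RELATION
# (proof-only; row «THM16I-NONINNER-AT-MODELTATE», K-L6; successor item (ii) of «COR218I-AT-MODELTATE»)

S. Mochizuki, *The étale theta function and its Frobenioid-theoretic manifestations* [EtTh], Publ. RIMS **45**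
(2009): Thm. 1.6 (i), PRIMS PDF p. 24 («`γ(Π^tp_{Ÿα}) = Π^tp_{Ÿβ}`») [cite: MochizukiEtTh2009, Thm 1.6 (i) p.24];
Cor. 2.18 (i), p. 60 (the named fact `RigidData.Cor218_i`, FACT-LIST F-0620) [cite: MochizukiEtTh2009, Cor 2.18(i) p.60];
§1 p. 13 (`K_N := K(ζ_N, q_X^{1/N})`, the Galois action on `(Δ^tp_X)^ell` — cyclotomic character on `Ẑ(1)·b`, Kummer
cocycle of the `q`-parameter in the corner) [cite: MochizukiEtTh2009, §1 p.13].

abc-iut cell, layer L6 / K-L6 instance column, seat abc-iut-L6-d6 (gen 6), row «THM16I-NONINNER-AT-MODELTATE»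
(abc-iut-L6-lead 2026-08-26T21:23:34Z (1): successor item (ii) of «COR218I-AT-MODELTATE», OPEN BY NAME). PROOF-ONLY:
no definition, no instance, no `Prop`-valued fact; nothing of another seat is edited or restated — inputs BY NAME
(abc-iut-L6-d6 gen 5 `Sec2Cor218iAtModelTateOfExtends` §1: `exists_restrict_of_map_deltaTemp_eq`,
`left_apply_inr_mem_ker_gfpSnd`, `levelHom_two_x_apply_gfpOf_zero`; abc-iut-w5-d051 `SettingModelGfpRigidity`:
`extension_spec`, `hHat_y_apply_eq`, `isUnit_coeff_of_exists`, `apply_mem_ker_gfpSnd_iff`; abc-iut-L2-t6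
`hHat_shear_of_level_eq_one` / `hHat_twist` / `levelHom_actχq_x` / `levelHom_actχq_y`; abc-iut-w4-d024 `ZHatLevel`).

THE QUESTION (memo `HOME/staging/L6/L6-d6/g5/COR218I-AT-MODELTATE.md`, «Next for a successor», second bullet): gen 5
proved Thm. 1.6 (i) at `modelχq p i 2` — `Γ(Π^tp_Ÿ) = Π^tp_Ÿ` — for `Δ^tp_X`-stabilising topological automorphisms `Γ` of
`Π^tp_X = Γ ⋊_{actχq} G_{ℚ_p}` lying over an INNER automorphism of `G_{ℚ_p}`
(`map_GtpYdd_eq_of_map_deltaTemp_eq_of_inner_modelχq`), and recorded «Thm16i at modelχq for NON-inner ν: needs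
`κ_p∘ν ≡ κ_p (mod 2)`». This file computes EXACTLY what a non-inner `ν` must do to `κ_p` modulo 2 and modulo 4; the
companion `Sec2Cor218iAtModelTateNonInnerModFour.lean` draws the theorems.

WHAT THIS FILE PROVES (numbers, not adjectives). Throughout `D = modelχq p i 2` (any `i`), `Γ` a topological
automorphism of `Π^tp_X` restricting to `φ` on `Γ` (`Γ(inl q) = inl (φ q)`), and for `σ ∈ G_{ℚ_p}`:
`Γ(inr σ) = inl (c σ) · inr (ν σ)` with `ν σ := (Γ (inr σ)).right`, `c σ := (Γ (inr σ)).left` — NO hypothesis on `ν`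
(`restrict_act_eq_conj`: `φ(σ·q) = c σ · (νσ·φ q) · (c σ)⁻¹`).
§1 `levelHom_two_y_left_apply_inr` — THE DEFECT FORMULA: the `b`-exponent of `c σ` mod `2` is
  `y(ĥ₂(c σ)) = κ₂(σ)^i − κ₂(ν σ)^i` (`κ₂ := level 2 ∘ κ_p`): gen 5's mod-2 Heisenberg `z`-computation run with `ν`
  (left side conjugated by `ĥ₂Φ(b^{κ_p(σ)^i})`, right side by `ĥ₂(b^{κ_p(νσ)^i})`, both acting on the odd-degree `ĥ₂φ(a)`);
  hence `c σ ∈ Δ^tp_{Y_2} ⟺ level 2 (κ_p σ ^ i) = level 2 (κ_p (ν σ) ^ i)` (`left_apply_inr_mem_dY_two_iff`).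
§2 `levelChar_four_sub_one_mul_eq` — THE LEVEL-4 ABELIANISED RELATION: reading `φ(σ·a) = c σ · (νσ·φ a) · (c σ)⁻¹` in the
  `y`-coordinate of `ĥ₄` (additive, conjugation-blind; `y(ĥ₄Φ(b))` and `deg φ(a)` are `±1`, the shear exponent is
  `2κ_p`) gives **`(χ₄(ν σ) − 1) · y(ĥ₄ φ(a)) = 2 · (κ₄(σ) − κ₄(ν σ))` in `ℤ/4`**; so `χ₄(νσ) = 1 ⇒ κ₂(σ) = κ₂(νσ)`
  (`level_two_kappaP_eq_of_levelChar_four_eq_one`), and `κ₂(σ) = κ₂(τ) ⟺ 2·(κ₄σ − κ₄τ) = 0` (both directions).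
Consequences (companion): (a) `i` even ⇒ Thm. 1.6 (i) for every `Δ`-stabilising `Γ`; (b) `χ₄ ≡ 1` (⟺ `p ≡ 1 (4)`) ⇒
the same for every `i` (⇒ F-0620 @ `modelχq` ⟸ `hextΔ` alone); (c) `p ≢ 1 (4)`, `i` odd: ⟺ the `b`-exponent of `Γ(a)` is even.

HONEST LABEL: `modelχq` is a SEMI-SYNTHETIC model of the typed [EtTh] §1 interface (statement/model-pair evidence);
F-0620 stays a FACT-policy row; nothing of [EtTh] (refereed) is asserted beyond the tree's proofs; no side is taken on
[IUTchIII] Cor. 3.12; typed ≠ proved; nothing here says abc is proved or refuted.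
-/

noncomputable section

namespace Literature.AnabelianGeometry.EtaleTheta

namespace SettingModel

open Literature.AnabelianGeometry.SemiGraphs Function Topology

variable (p : ℕ) [Fact p.Prime] (i : ℤ)

/-! ## §0. Small arithmetic and the restriction `φ` -/

/-- `level 2 (T)` as an element of `ℤ/2` (notation-free helper): `t(T) := toAdd (level 2 T)`. Units of `ℤ/2` are `1`.
[folklore] -/
private theorem zmod_two_eq_one_of_mul_eq_one' : ∀ a b : ZMod 2, a * b = 1 → a = 1 := by decide

/-- In `ℤ/4`, a unit is `1` or `−1`. [folklore] -/
private theorem zmod_four_eq_or_of_mul_eq_one : ∀ a b : ZMod 4, a * b = 1 → a = 1 ∨ a = -1 := by decide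

/-- The mod-`4` bookkeeping of §2: from `c₁ + c₂·(2kσ) = χ·c₁ + (2kτ)·d` with `c₂, d ∈ {±1}` one gets
`(χ − 1)·c₁ = 2·(kσ − kτ)`. [folklore] -/
private theorem zmod_four_relation :
    ∀ c₁ c₂ d χ kσ kτ : ZMod 4, (c₂ = 1 ∨ c₂ = -1) → (d = 1 ∨ d = -1) →
      c₁ * 1 + c₂ * (χ * 0 + 2 * kσ * 1) = χ * c₁ + 2 * kτ * d → (χ - 1) * c₁ = 2 * (kσ - kτ) := by
  intro c₁ c₂ d χ kσ kτ hc hd h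
  rcases hc with rfl | rfl <;> rcases hd with rfl | rfl <;> revert c₁ χ kσ kτ <;> decide

/-- `2·(a − b) = 0` in `ℤ/4` forces `a ≡ b (mod 2)`: `a = b` or `a = b + 2`. [folklore] -/
private theorem zmod_four_eq_or_eq_add_two :
    ∀ a b : ZMod ((4 : ℕ+) : ℕ), 2 * (a - b) = 0 → a = b ∨ a = b + 2 := by
  change ∀ a b : ZMod 4, 2 * (a - b) = 0 → a = b ∨ a = b + 2
  decide

/-- Every square in `Heis(ℤ/2)` of an element with `x = 0` is trivial. [folklore] -/
private theorem heis_two_sq_eq_one_of_x_eq_zero' (Q : Heis (ZMod ((2 : ℕ+) : ℕ))) (hQ : Q.x = 0) : Q ^ 2 = 1 := by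
  rw [Heis.pow_eq_of_x_eq_zero Q hQ 2]
  have h2 : ((2 : ℕ) : ZMod ((2 : ℕ+) : ℕ)) = 0 := by decide
  rw [h2, zero_mul, zero_mul]
  rfl

/-- The mod-`2` arithmetic of the Heisenberg relation with TWO conjugators `(0,t,*)`, `(0,t',0)`: the `y`-coordinate
of the cocycle value is `t − t'`. [folklore] -/
private theorem heis_two_y_eq_sub (P₁ A Lc : Heis (ZMod ((2 : ℕ+) : ℕ))) (t t' : ZMod ((2 : ℕ+) : ℕ))
    (hP₁x : P₁.x = 0) (hP₁y : P₁.y = t) (hAx : A.x = 1) (hLcx : Lc.x = 0)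
    (hE : P₁ * A * P₁⁻¹ =
      Lc * ((⟨0, t', 0⟩ : Heis (ZMod ((2 : ℕ+) : ℕ))) * A * (⟨0, t', 0⟩ : Heis (ZMod ((2 : ℕ+) : ℕ)))⁻¹) * Lc⁻¹) :
    Lc.y = t - t' := by
  have hz := congrArg Heis.z hE
  simp only [Heis.mul_z, Heis.mul_x, Heis.mul_y, Heis.inv_x, Heis.inv_y, Heis.inv_z, hP₁x, hP₁y, hAx, hLcx] at hz
  linear_combination hz

/-- If `Γ` stabilises `Δ^tp_X`, so does `Γ⁻¹`. [cite: MochizukiEtTh2009, §1 p.12] -/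
theorem map_deltaTempχq_symm_eq (Γ : PiTpχq p i 2 ≃ₜ* PiTpχq p i 2)
    (hΔ : (curveχq p i 2).DeltaTemp.map Γ.toMulEquiv.toMonoidHom = (curveχq p i 2).DeltaTemp) :
    (curveχq p i 2).DeltaTemp.map Γ.symm.toMulEquiv.toMonoidHom = (curveχq p i 2).DeltaTemp := by
  refine le_antisymm ?_ ?_
  · rintro _ ⟨x, hx, rfl⟩
    have hx2 : x ∈ (curveχq p i 2).DeltaTemp.map Γ.toMulEquiv.toMonoidHom := by rw [hΔ]; exact hx
    obtain ⟨y, hy, rfl⟩ := hx2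
    change Γ.symm (Γ y) ∈ _
    rw [Γ.symm_apply_apply]; exact hy
  · intro x hx
    refine ⟨Γ x, ?_, Γ.symm_apply_apply x⟩
    rw [← hΔ]; exact ⟨x, hx, rfl⟩

/-- **The degree of `φ(a)` is `±1`** for a topological automorphism `φ` of `Γ = F̂₂ ×_Ẑ ℤ` (`φ` induces `±1` on
`Γ/Δ^tp_Y ≅ ℤ`). [cite: MochizukiEtTh2009, §1 p.12] -/
theorem toAdd_gfpSnd_apply_gfpOf_zero (φ : Gfp ≃ₜ* Gfp) :
    Multiplicative.toAdd (gfpSnd (φ (gfpOf (FreeGroup.of 0)))) = 1 ∨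
      Multiplicative.toAdd (gfpSnd (φ (gfpOf (FreeGroup.of 0)))) = -1 := by
  set qa : Gfp := gfpOf (FreeGroup.of 0) with hqa
  have hqa1 : gfpSnd qa = Multiplicative.ofAdd 1 := by
    rw [hqa, gfpSnd_gfpOf, expA_apply, heisHom_of_zero]
  set d : ℤ := Multiplicative.toAdd (gfpSnd (φ qa)) with hd
  have hmul : ∀ q : Gfp, Multiplicative.toAdd (gfpSnd (φ q)) = Multiplicative.toAdd (gfpSnd q) * d := by
    intro q
    set n : ℤ := Multiplicative.toAdd (gfpSnd q) with hn
    have hk : q * (qa ^ n)⁻¹ ∈ gfpSnd.ker := by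
      rw [MonoidHom.mem_ker, map_mul, map_inv, map_zpow, hqa1]
      apply Multiplicative.toAdd.injective
      rw [toAdd_mul, toAdd_inv, toAdd_zpow, toAdd_ofAdd, smul_eq_mul, mul_one, toAdd_one, ← hn, add_neg_cancel]
    have hk' : φ (q * (qa ^ n)⁻¹) ∈ gfpSnd.ker := (apply_mem_ker_gfpSnd_iff φ _).mpr hk
    rw [MonoidHom.mem_ker, map_mul, map_inv, map_zpow, map_mul, map_inv, map_zpow] at hk'
    have := congrArg Multiplicative.toAdd hk'
    rw [toAdd_mul, toAdd_inv, toAdd_zpow, toAdd_one, smul_eq_mul] at this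
    linarith
  obtain ⟨q, hq⟩ := φ.surjective qa
  have h1 : Multiplicative.toAdd (gfpSnd q) * d = 1 := by
    rw [← hmul q, hq, hqa1, toAdd_ofAdd]
  exact Int.eq_one_or_neg_one_of_mul_eq_one ((mul_comm _ _).trans h1)

/-- Hence the `x`-coordinate of `ĥ_N(φ(a))` is `±1`. [cite: MochizukiEtTh2009, §1 p.12] -/
theorem levelHom_x_apply_gfpOf_zero_eq_or (N : ℕ+) (φ : Gfp ≃ₜ* Gfp) :
    (levelHom N (φ (gfpOf (FreeGroup.of 0)))).x = 1 ∨ (levelHom N (φ (gfpOf (FreeGroup.of 0)))).x = -1 := by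
  rw [levelHom_x_eq_cast]
  rcases toAdd_gfpSnd_apply_gfpOf_zero φ with h | h
  · left; rw [h, Int.cast_one]
  · right; rw [h, Int.cast_neg, Int.cast_one]

/-! ## §1. The defect formula: `y(ĥ₂(c σ)) = κ₂(σ)^i − κ₂(ν σ)^i` -/

/-- `Γ(inr σ) = inl (c σ) · inr (ν σ)` and the TWISTED relation `φ(σ·q) = c σ · (νσ · φ q) · (c σ)⁻¹` in `Γ`, for a
topological automorphism `Γ` restricting to `φ` on `Γ` (no hypothesis on `ν σ := (Γ (inr σ)).right`).
[cite: MochizukiEtTh2009, §1 p.12] -/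
theorem restrict_act_eq_conj (Γ : PiTpχq p i 2 ≃ₜ* PiTpχq p i 2) (φ : Gfp ≃ₜ* Gfp)
    (hφ : ∀ q : Gfp, Γ (SemidirectProduct.inl q) = SemidirectProduct.inl (φ q)) (σ : GQp p) (q : Gfp) :
    φ (actχq p i 2 σ q) = (Γ (SemidirectProduct.inr σ)).left *
      actχq p i 2 (Γ (SemidirectProduct.inr σ)).right (φ q) * ((Γ (SemidirectProduct.inr σ)).left)⁻¹ := by
  set c : Gfp := (Γ (SemidirectProduct.inr σ)).left with hc
  set τ : GQp p := (Γ (SemidirectProduct.inr σ)).right with hτ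
  have hΓσ : Γ (SemidirectProduct.inr σ) = SemidirectProduct.inl c * SemidirectProduct.inr τ :=
    (SemidirectProduct.inl_left_mul_inr_right (Γ (SemidirectProduct.inr σ))).symm
  refine (SemidirectProduct.inl_injective (φ := actχq p i 2)) ?_
  calc (SemidirectProduct.inl (φ (actχq p i 2 σ q)) : PiTpχq p i 2)
      = Γ (SemidirectProduct.inl (actχq p i 2 σ q)) := (hφ _).symm
    _ = Γ (SemidirectProduct.inr σ * SemidirectProduct.inl q * SemidirectProduct.inr σ⁻¹) := by
        rw [← SemidirectProduct.inl_aut]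
    _ = Γ (SemidirectProduct.inr σ) * SemidirectProduct.inl (φ q) * (Γ (SemidirectProduct.inr σ))⁻¹ := by
        rw [map_mul, map_mul, hφ, map_inv, map_inv]
    _ = SemidirectProduct.inl c * (SemidirectProduct.inr τ * SemidirectProduct.inl (φ q) *
          SemidirectProduct.inr τ⁻¹) * (SemidirectProduct.inl c)⁻¹ := by
        rw [hΓσ, mul_inv_rev, ← map_inv]; simp only [mul_assoc]
    _ = SemidirectProduct.inl c * SemidirectProduct.inl (actχq p i 2 τ (φ q)) * (SemidirectProduct.inl c)⁻¹ := by
        rw [← SemidirectProduct.inl_aut]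
    _ = SemidirectProduct.inl (c * actχq p i 2 τ (φ q) * c⁻¹) := by rw [map_mul, map_mul, map_inv]

/-- **The defect formula (core of the file).** Let `Γ` be a topological automorphism of `Π^tp_X(modelχq p i 2)`
restricting to `φ` on `Γ`; write `Γ(inr σ) = (c σ, ν σ)`. Then the `b`-exponent of `c σ` mod `2` is
`y(ĥ₂(c σ)) = κ₂(σ)^i − κ₂(ν σ)^i`: the relation `φ(σ·a) = c σ · (νσ·φ(a)) · (c σ)⁻¹` read in `Heis(ℤ/2)` (stage-2 action
= `Inn(b^{κ_p^i})` only at level `2`: `χ₂ ≡ 1`, shear `κ_p² ≡ 0`) compares the conjugators `ĥ₂Φ(b^{κ_p(σ)^i}) = (0, κ₂(σ)^i, *)`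
and `ĥ₂(b^{κ_p(νσ)^i}) = (0, κ₂(νσ)^i, 0)` of the odd-degree element `ĥ₂φ(a)`. [cite: MochizukiEtTh2009, Thm 1.6 (i) p.24] -/
theorem levelHom_two_y_left_apply_inr (Γ : PiTpχq p i 2 ≃ₜ* PiTpχq p i 2) (φ : Gfp ≃ₜ* Gfp)
    (hφ : ∀ q : Gfp, Γ (SemidirectProduct.inl q) = SemidirectProduct.inl (φ q)) (σ : GQp p) :
    (levelHom 2 (Γ (SemidirectProduct.inr σ)).left).y =
      Multiplicative.toAdd (ZHatLevel.level 2 (kappaP p σ ^ i)) -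
        Multiplicative.toAdd (ZHatLevel.level 2 (kappaP p (Γ (SemidirectProduct.inr σ)).right ^ i)) := by
  set c : Gfp := (Γ (SemidirectProduct.inr σ)).left with hc
  set τ : GQp p := (Γ (SemidirectProduct.inr σ)).right with hτ
  have hcdeg : c ∈ gfpSnd.ker := left_apply_inr_mem_ker_gfpSnd p i Γ σ
  -- notation
  set qa : Gfp := gfpOf (FreeGroup.of 0) with hqa
  set T : ZH := kappaP p σ ^ i with hT
  set S : ZH := kappaP p σ ^ (2 : ℤ) with hS
  set T' : ZH := kappaP p τ ^ i with hT'
  set S' : ZH := kappaP p τ ^ (2 : ℤ) with hS'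
  have hS'2 : ZHatLevel.level 2 S' = 1 := by
    rw [hS', show ((2 : ℤ)) = ((2 : ℕ) : ℤ) from rfl, zpow_natCast]; exact level_two_sq _
  -- the relation `φ (σ·qa) = c · τ·(φ qa) · c⁻¹` in `Γ`
  have hE : φ (actχq p i 2 σ qa) = c * actχq p i 2 τ (φ qa) * c⁻¹ := restrict_act_eq_conj p i Γ φ hφ σ qa
  -- extend `φ` along the profinite completion `pr₁ : Γ → F̂₂`
  obtain ⟨Φ, hΦ⟩ := isProfiniteCompletion_gfpFst.exists_extension
    (⟨gfpFst.toMonoidHom.comp φ.toMulEquiv.toMonoidHom, gfpFst.continuous.comp φ.continuous⟩ : Gfp →ₜ* F₂hatT)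
  have hΦ' : ∀ q : Gfp, Φ (gfpFst q) = gfpFst (φ q) := fun q => hΦ q
  obtain ⟨hker, hb⟩ := extension_spec φ hΦ'
  -- the pieces in `Heis(ℤ/2)`
  have hB : hHat 2 (bPow T) = ⟨0, Multiplicative.toAdd (ZHatLevel.level 2 T), 0⟩ := hHat_bPow 2 T
  have hB' : hHat 2 (bPow T') = ⟨0, Multiplicative.toAdd (ZHatLevel.level 2 T'), 0⟩ := hHat_bPow 2 T'
  set t : ZMod ((2 : ℕ+) : ℕ) := Multiplicative.toAdd (ZHatLevel.level 2 T) with ht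
  set t' : ZMod ((2 : ℕ+) : ℕ) := Multiplicative.toAdd (ZHatLevel.level 2 T') with ht'
  set P₁ : Heis (ZMod ((2 : ℕ+) : ℕ)) := hHat 2 (Φ (bPow T)) with hP₁
  set A : Heis (ZMod ((2 : ℕ+) : ℕ)) := levelHom 2 (φ qa) with hA
  have hP₁x : P₁.x = 0 := hHat_x_eq_zero_of_eHat_eq_one 2 (hker _ (eHat_bPow T))
  have hc₂ : (hHat 2 (Φ (eta (FreeGroup.of 1)))).y = 1 := by
    obtain ⟨v, hv⟩ := (isUnit_coeff_of_exists Φ 2 hb).exists_right_inv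
    exact zmod_two_eq_one_of_mul_eq_one' _ _ hv
  have hP₁y : P₁.y = t := by
    rw [hP₁, hHat_y_apply_eq_of_eHat_eq_one Φ 2 (eHat_bPow T), hc₂, one_mul, hB]
  have hP₂ : hHat 2 (Φ (bPow S)) = 1 := by
    have hSq : bPow S = bPow (kappaP p σ) ^ 2 := by
      rw [hS, show ((2 : ℤ)) = ((2 : ℕ) : ℤ) from rfl, zpow_natCast, map_pow]
    rw [hSq, map_pow, map_pow]
    exact heis_two_sq_eq_one_of_x_eq_zero' _ (hHat_x_eq_zero_of_eHat_eq_one 2 (hker _ (eHat_bPow _)))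
  have hAx : A.x = 1 := levelHom_two_x_apply_gfpOf_zero φ
  have hLcx : (levelHom 2 c).x = 0 := levelHom_x_eq_zero hcdeg
  -- the stage-2 action of `τ` on `ĥ_2`: `Inn(ĥ_2 b^{T'})` only
  have hact : ∀ X : F₂hatT, hHat 2 (actHatχq p i 2 τ X) = hHat 2 (bPow T') * hHat 2 X * (hHat 2 (bPow T'))⁻¹ := by
    intro X
    rw [actHatχq_apply, affTwist₃_apply]
    change hHat 2 (innB T' (shear S' (twist (chi p τ) X))) = _
    rw [innB_apply, map_mul, map_mul, map_inv, hHat_shear_of_level_eq_one 2 hS'2, hHat_twist, levelChar_two_eq_one,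
      Heis.diagTwist_apply, one_mul, one_mul]
  -- LHS of the relation in `Heis(ℤ/2)`
  have hL : levelHom 2 (φ (actχq p i 2 σ qa)) = P₁ * A * P₁⁻¹ := by
    change hHat 2 (gfpFst (φ (actχq p i 2 σ qa))) = _
    rw [← hΦ', gfpFst_actχq, actHatχq_apply, affTwist₃_apply]
    change hHat 2 (Φ (innB T (shear S (twist (chi p σ) (gfpFst qa))))) = _
    have hqa1 : gfpFst qa = eta (FreeGroup.of 0) := rfl
    rw [hqa1, twist_eta_of_zero, shear_eta_of_zero, innB_apply, map_mul, map_mul, map_mul, map_inv,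
      map_mul, map_mul, map_mul, map_inv, hP₂, mul_one, hA]
    change _ = P₁ * hHat 2 (gfpFst (φ qa)) * P₁⁻¹
    rw [← hΦ' qa, hqa1]
  -- RHS of the relation in `Heis(ℤ/2)`
  have hR : levelHom 2 (c * actχq p i 2 τ (φ qa) * c⁻¹) =
      levelHom 2 c * (hHat 2 (bPow T') * A * (hHat 2 (bPow T'))⁻¹) * (levelHom 2 c)⁻¹ := by
    rw [map_mul, map_mul, map_inv]
    congr 2
    change hHat 2 (gfpFst (actχq p i 2 τ (φ qa))) = _
    rw [gfpFst_actχq, hact]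
    rfl
  have hEq : P₁ * A * P₁⁻¹ = levelHom 2 c *
      ((⟨0, t', 0⟩ : Heis (ZMod ((2 : ℕ+) : ℕ))) * A * (⟨0, t', 0⟩ : Heis (ZMod ((2 : ℕ+) : ℕ)))⁻¹) *
        (levelHom 2 c)⁻¹ := by
    rw [← hL, hE, hR, hB']
  exact heis_two_y_eq_sub P₁ A (levelHom 2 c) t t' hP₁x hP₁y hAx hLcx hEq

/-- **Criterion.** With `Γ(inr σ) = (c σ, ν σ)`: `c σ ∈ Δ^tp_{Y_2} ⟺ level 2 (κ_p σ ^ i) = level 2 (κ_p (ν σ) ^ i)`.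
[cite: MochizukiEtTh2009, Thm 1.6 (i) p.24] -/
theorem left_apply_inr_mem_dY_two_iff (Γ : PiTpχq p i 2 ≃ₜ* PiTpχq p i 2) (φ : Gfp ≃ₜ* Gfp)
    (hφ : ∀ q : Gfp, Γ (SemidirectProduct.inl q) = SemidirectProduct.inl (φ q)) (σ : GQp p) :
    (Γ (SemidirectProduct.inr σ)).left ∈ dY 2 ↔
      ZHatLevel.level 2 (kappaP p σ ^ i) = ZHatLevel.level 2 (kappaP p (Γ (SemidirectProduct.inr σ)).right ^ i) := by
  have hcdeg : (Γ (SemidirectProduct.inr σ)).left ∈ gfpSnd.ker := left_apply_inr_mem_ker_gfpSnd p i Γ σ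
  have hy := levelHom_two_y_left_apply_inr p i Γ φ hφ σ
  constructor
  · intro h
    obtain ⟨-, h2⟩ := Subgroup.mem_inf.mp h
    obtain ⟨-, hy0⟩ := Subgroup.mem_comap.mp h2
    change (levelHom 2 (Γ (SemidirectProduct.inr σ)).left).y = 0 at hy0
    rw [hy0] at hy
    exact Multiplicative.toAdd.injective (sub_eq_zero.mp hy.symm)
  · intro h
    refine Subgroup.mem_inf.mpr ⟨hcdeg, Subgroup.mem_comap.mpr ⟨levelHom_x_eq_zero hcdeg, ?_⟩⟩
    change (levelHom 2 (Γ (SemidirectProduct.inr σ)).left).y = 0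
    rw [hy, h, sub_self]

/-! ## §2. The level-4 abelianised relation -/

/-- **`(χ₄(ν σ) − 1) · y(ĥ₄ φ(a)) = 2 · (κ₄(σ) − κ₄(ν σ))` in `ℤ/4`.** The `y`-coordinate of `ĥ₄` is an additive,
conjugation-invariant function; applied to `φ(σ·a) = c σ · (νσ·φ(a)) · (c σ)⁻¹` with `y(ĥ₄Φ(x)) = c₁·x(ĥ₄x) + c₂·y(ĥ₄x)`
(abc-iut-w5-d051), the stage-2 level law `y(τ·γ) = χ₄(τ)·y(γ) + 2κ₄(τ)·x(γ)` (abc-iut-L2-t6) and `x(ĥ₄φ(a)) = ±1`,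
`c₂ = ±1`. [cite: MochizukiEtTh2009, §1 p.13] -/
theorem levelChar_four_sub_one_mul_eq (Γ : PiTpχq p i 2 ≃ₜ* PiTpχq p i 2) (φ : Gfp ≃ₜ* Gfp)
    (hφ : ∀ q : Gfp, Γ (SemidirectProduct.inl q) = SemidirectProduct.inl (φ q)) (σ : GQp p) :
    (ZHatLevel.levelChar 4 (chi p (Γ (SemidirectProduct.inr σ)).right) - 1) *
        (levelHom 4 (φ (gfpOf (FreeGroup.of 0)))).y =
      2 * (Multiplicative.toAdd (ZHatLevel.level 4 (kappaP p σ)) -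
        Multiplicative.toAdd (ZHatLevel.level 4 (kappaP p (Γ (SemidirectProduct.inr σ)).right))) := by
  set c : Gfp := (Γ (SemidirectProduct.inr σ)).left with hc
  set τ : GQp p := (Γ (SemidirectProduct.inr σ)).right with hτ
  set qa : Gfp := gfpOf (FreeGroup.of 0) with hqa
  have hE : φ (actχq p i 2 σ qa) = c * actχq p i 2 τ (φ qa) * c⁻¹ := restrict_act_eq_conj p i Γ φ hφ σ qa
  obtain ⟨Φ, hΦ⟩ := isProfiniteCompletion_gfpFst.exists_extension
    (⟨gfpFst.toMonoidHom.comp φ.toMulEquiv.toMonoidHom, gfpFst.continuous.comp φ.continuous⟩ : Gfp →ₜ* F₂hatT)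
  have hΦ' : ∀ q : Gfp, Φ (gfpFst q) = gfpFst (φ q) := fun q => hΦ q
  obtain ⟨-, hb⟩ := extension_spec φ hΦ'
  have hqa1 : gfpFst qa = eta (FreeGroup.of 0) := rfl
  -- `levelHom 4 ∘ φ = ĥ₄ ∘ Φ ∘ pr₁`
  have hlev : ∀ q : Gfp, levelHom 4 (φ q) = hHat 4 (Φ (gfpFst q)) := fun q => by
    change hHat 4 (gfpFst (φ q)) = _; rw [hΦ']
  -- the coefficients
  set c₁ : ZMod ((4 : ℕ+) : ℕ) := (hHat 4 (Φ (eta (FreeGroup.of 0)))).y with hc₁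
  set c₂ : ZMod ((4 : ℕ+) : ℕ) := (hHat 4 (Φ (eta (FreeGroup.of 1)))).y with hc₂
  have hc₁' : (levelHom 4 (φ qa)).y = c₁ := by rw [hlev, hqa1]
  have hc₂u : c₂ = 1 ∨ c₂ = -1 := by
    obtain ⟨v, hv⟩ := (isUnit_coeff_of_exists Φ 4 hb).exists_right_inv
    exact zmod_four_eq_or_of_mul_eq_one _ _ hv
  have hd := levelHom_x_apply_gfpOf_zero_eq_or 4 φ
  have hqax : (levelHom 4 qa).x = 1 := by rw [hqa, levelHom_gfpOf_a]
  have hqay : (levelHom 4 qa).y = 0 := by rw [hqa, levelHom_gfpOf_a]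
  -- squares at level 4: `toAdd (level 4 (z²)) = 2 · toAdd (level 4 z)`
  have hsq : ∀ z : ZH, Multiplicative.toAdd (ZHatLevel.level 4 (z ^ (2 : ℤ))) =
      2 * Multiplicative.toAdd (ZHatLevel.level 4 z) := fun z => by
    rw [show ((2 : ℤ)) = ((2 : ℕ) : ℤ) from rfl, zpow_natCast, map_pow, toAdd_pow, nsmul_eq_mul, Nat.cast_ofNat]
  -- LHS `y`
  have hLy : (levelHom 4 (φ (actχq p i 2 σ qa))).y =
      c₁ * 1 + c₂ * (ZHatLevel.levelChar 4 (chi p σ) * 0 +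
        2 * Multiplicative.toAdd (ZHatLevel.level 4 (kappaP p σ)) * 1) := by
    rw [hlev, hHat_y_apply_eq Φ 4, ← hc₁, ← hc₂]
    change c₁ * (levelHom 4 (actχq p i 2 σ qa)).x + c₂ * (levelHom 4 (actχq p i 2 σ qa)).y = _
    rw [levelHom_actχq_x, levelHom_actχq_y, hqax, hqay, hsq]
  -- RHS `y`
  have hRy : (levelHom 4 (c * actχq p i 2 τ (φ qa) * c⁻¹)).y =
      ZHatLevel.levelChar 4 (chi p τ) * c₁ +
        2 * Multiplicative.toAdd (ZHatLevel.level 4 (kappaP p τ)) * (levelHom 4 (φ qa)).x := by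
    rw [map_mul, map_mul, map_inv, Heis.mul_y, Heis.mul_y, Heis.inv_y, levelHom_actχq_y, hc₁', hsq]
    ring
  have key : c₁ * 1 + c₂ * (ZHatLevel.levelChar 4 (chi p σ) * 0 +
      2 * Multiplicative.toAdd (ZHatLevel.level 4 (kappaP p σ)) * 1) =
        ZHatLevel.levelChar 4 (chi p τ) * c₁ +
          2 * Multiplicative.toAdd (ZHatLevel.level 4 (kappaP p τ)) * (levelHom 4 (φ qa)).x := by
    rw [← hLy, ← hRy, hE]
  rw [hc₁']
  rcases hd with hd | hd
  · rw [hd] at key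
    exact zmod_four_relation c₁ c₂ 1 _ _ _ hc₂u (Or.inl rfl) key
  · rw [hd] at key
    exact zmod_four_relation c₁ c₂ (-1) _ _ _ hc₂u (Or.inr rfl) key

/-- The level characters at `4` and `2` are compatible: `κ₄(z) mod 2 = κ₂(z)`. [cite: RibesZalesskii2010, Thm 2.7.1] -/
theorem castHom_level_four (z : ZH) :
    ZMod.castHom (show ((2 : ℕ+) : ℕ) ∣ ((4 : ℕ+) : ℕ) by norm_num) (ZMod ((2 : ℕ+) : ℕ))
        (Multiplicative.toAdd (ZHatLevel.level 4 z)) = Multiplicative.toAdd (ZHatLevel.level 2 z) :=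
  (ZHatLevel.LevelFamily.ofZHat z).compat 2 4 (show ((2 : ℕ+) : ℕ) ∣ ((4 : ℕ+) : ℕ) by norm_num)

/-- `2·(κ₄(σ) − κ₄(τ)) = 0` in `ℤ/4` ⇒ `κ₂(σ) = κ₂(τ)`. [cite: MochizukiEtTh2009, §1 p.13] -/
theorem level_two_kappaP_eq_of_two_mul_sub_eq_zero {σ τ : GQp p}
    (h : 2 * (Multiplicative.toAdd (ZHatLevel.level 4 (kappaP p σ)) -
      Multiplicative.toAdd (ZHatLevel.level 4 (kappaP p τ))) = 0) :
    ZHatLevel.level 2 (kappaP p σ) = ZHatLevel.level 2 (kappaP p τ) := by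
  apply Multiplicative.toAdd.injective
  rw [← castHom_level_four, ← castHom_level_four]
  rcases zmod_four_eq_or_eq_add_two _ _ h with h | h
  · rw [h]
  · rw [h, map_add]
    have h2 : ZMod.castHom (show ((2 : ℕ+) : ℕ) ∣ ((4 : ℕ+) : ℕ) by norm_num) (ZMod ((2 : ℕ+) : ℕ))
        (2 : ZMod ((4 : ℕ+) : ℕ)) = 0 := by
      rw [map_ofNat]; decide
    rw [h2, add_zero]

/-- Conversely `κ₂(σ) = κ₂(τ)` ⇒ `2·(κ₄(σ) − κ₄(τ)) = 0` in `ℤ/4`. [cite: MochizukiEtTh2009, §1 p.13] -/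
theorem two_mul_sub_eq_zero_of_level_two_kappaP_eq {σ τ : GQp p}
    (h : ZHatLevel.level 2 (kappaP p σ) = ZHatLevel.level 2 (kappaP p τ)) :
    2 * (Multiplicative.toAdd (ZHatLevel.level 4 (kappaP p σ)) -
      Multiplicative.toAdd (ZHatLevel.level 4 (kappaP p τ))) = 0 := by
  have h' := congrArg Multiplicative.toAdd h
  rw [← castHom_level_four, ← castHom_level_four] at h'
  revert h'
  generalize Multiplicative.toAdd (ZHatLevel.level 4 (kappaP p σ)) = a
  generalize Multiplicative.toAdd (ZHatLevel.level 4 (kappaP p τ)) = b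
  revert a b
  change ∀ a b : ZMod 4, ZMod.castHom _ (ZMod 2) a = ZMod.castHom _ (ZMod 2) b → 2 * (a - b) = 0
  decide

/-- **`χ₄(ν σ) = 1 ⇒ κ₂(σ) = κ₂(ν σ).`** [cite: MochizukiEtTh2009, §1 p.13] -/
theorem level_two_kappaP_eq_of_levelChar_four_eq_one (Γ : PiTpχq p i 2 ≃ₜ* PiTpχq p i 2) (φ : Gfp ≃ₜ* Gfp)
    (hφ : ∀ q : Gfp, Γ (SemidirectProduct.inl q) = SemidirectProduct.inl (φ q)) (σ : GQp p)
    (h4 : ZHatLevel.levelChar 4 (chi p (Γ (SemidirectProduct.inr σ)).right) = 1) :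
    ZHatLevel.level 2 (kappaP p σ) = ZHatLevel.level 2 (kappaP p (Γ (SemidirectProduct.inr σ)).right) := by
  have key := levelChar_four_sub_one_mul_eq p i Γ φ hφ σ
  rw [h4, sub_self, zero_mul] at key
  exact level_two_kappaP_eq_of_two_mul_sub_eq_zero p key.symm


/-- The level-`2` `y`-coordinate is the reduction of the level-`4` one. [cite: MochizukiEtTh2009, §1 p.18] -/
theorem levelHom_two_y_eq_castHom (γ : Gfp) :
    (levelHom 2 γ).y = ZMod.castHom (show ((2 : ℕ+) : ℕ) ∣ ((4 : ℕ+) : ℕ) by norm_num) (ZMod ((2 : ℕ+) : ℕ))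
      (levelHom 4 γ).y := by
  have e := map_hHat_of_dvd (show ((2 : ℕ+) : ℕ) ∣ ((4 : ℕ+) : ℕ) by norm_num) (gfpFst γ)
  change Heis.map _ (levelHom 4 γ) = levelHom 2 γ at e
  rw [← e, Heis.map_apply]

end SettingModel

end Literature.AnabelianGeometry.EtaleTheta

end
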